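import Summits.PneNP.PneNP.Theorems.ChebyshevTracialDesignVirtualKernel
import Summits.PneNP.PneNP.Theorems.ChebyshevTracialDesignLevelMarginals
import Summits.PneNP.PneNP.Theorems.ChebyshevTracialDesignSliceLadders
import Summits.PneNP.PneNP.Theorems.ChebyshevTracialDesignJuntaVirtualPositivity
import HarnessLib

/-!
# Cell pnp-psdrank, route `ChebyshevTracialDesign`: the averaged Grigoriev functional is UNBIASED (the 'uniform background'
# of the psd crux; eng g10, MEMO-10 §2(c))

Support file for the crux `TracialDecayExp20` (stmt-PneNP-19878). Grigoriev's knapsack pseudo-expectation around a perfect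
matching `M` of `K_n`, in the tree's closure convention `Ẽ_M[ζ_A] = knapsackMoment |M| (t/2) x_M(A)`
(`x_M(A) = #{e ∈ M : e meets A}`; `…VirtualKernel`, `…LowDegreePricing`), is NOT a positive functional for a fixed `M` — that is the whole
difficulty of the route — but its AVERAGE over a uniformly random perfect matching is the honest uniform expectation on the `t`-cuts:

* `sum_pmatch_knapsackMoment_meet` — for `|A| ≤ t`, `2t ≤ n`:
  `Σ_{M} knapsackMoment |M| (t/2) x_M(A) = |PM_n| · C(n − |A|, t − |A|) / C(n, t)`  (`= |PM_n| · P_{|U|=t}[A ⊆ U]`);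
* `sum_pmatch_virtual_value_eq` — hence for every coefficient vector `q` supported on sets of size `≤ t`:
  `Σ_M Σ_A q_A · knapsackMoment |M| (t/2) x_M(A) = (|PM_n| / C(n,t)) · Σ_{|U| = t} (zeta q)(U)`,
  i.e. `E_M Ẽ_M[f] = E_{|U| = t} f(U)` for every multilinear `f = zeta q` of degree `≤ t`.

Proof: the superset identity of `…VirtualKernel` (eng g9, p484495) reduces `A` to the `t`-cuts `U ⊇ A`; the inner sum
`Σ_M knapsackMoment |M| (t/2) x_M(U)` does not depend on the `t`-set `U` (relabelling by `𝔖ₙ`, `…LevelMarginals`); and its common value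
is read off `A = ∅`, where the same identity gives `Σ_{|U|=t} Σ_M K = Σ_M K(0) = |PM_n|`.
Reading (eng MEMO-10 §2(c), 'uniform background'): applied to the coefficient vector of a truncation `(1_X)^{≤D}` (`D ≤ t`) the
second identity says that the virtual value of a cut family `X`, averaged over the matching, is the mean of the truncated polynomial over
the `t`-cuts — which is the density `μ(X)` itself, the lifted harmonic layers of degree `≥ 1` having zero mean on the slice
(`…BinomialMomentSums.sum_supersets_zeta_iter` from `V = ∅`; eng MEMO-9's exact mean checks `E_M[Φ_K(X,M)] = μ(X)`). So a matching side aligned with ONE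
class of a multi-class psd strategy pays the positive background of all the other classes — the mechanism behind 'packing more than `r`
aligned families into dimension `r` loses' (MEMO-10 §2.3, kit j269302).
No definitions. [cite: Grigoriev2001, Lemma 1.4 (PDF p. 8)] [cite: Rothvoss2017, §2 (PDF p. 6)]
Stature: support/instrument. WHAT THIS IS NOT: not virtual positivity, nothing on psd rank, no P-vs-NP content.
-/

set_option linter.dupNamespace false -- `Summit.PneNP.PneNP.…`: summit = sub-problem (D-0017)

noncomputable section

namespace Summit.PneNP.PneNP.Theorems.ChebyshevTracialDesignVirtualUnbiased

open Finset Literature.Barriers.PneNP Literature.Computability.Complexity Literature.Combinatorics.Optimization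
open Literature.Combinatorics.SimpleGraph.CycleSpace
open Literature.Combinatorics.AssociationSchemes.JohnsonHarmonics
open Summit.PneNP.PneNP.Theorems.ChebyshevTracialDesignVirtualKernel
open Summit.PneNP.PneNP.Theorems.ChebyshevTracialDesignLevelMarginals
open Summit.PneNP.PneNP.Theorems.ChebyshevTracialDesignSliceLadders
open Summit.PneNP.PneNP.Theorems.ChebyshevTracialDesignJunta (two_mul_card_pmatch)

variable {n : ℕ}

/-! ### §1 Relabelling invariance of the kernel sums -/

/-- A relabelled pair meets the relabelled set iff the pair met the set. -/
theorem meets_image_map_iff (π : Equiv.Perm (Fin n)) (A : Finset (Fin n)) (e : Sym2 (Fin n)) :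
    (∃ a ∈ A.image π, a ∈ Sym2.map π e) ↔ ∃ a ∈ A, a ∈ e := by
  constructor
  · rintro ⟨b, hb, hbe⟩
    obtain ⟨a, ha, hab⟩ := mem_image.1 hb
    obtain ⟨a', ha'e, ha'b⟩ := Sym2.mem_map.1 hbe
    have : a' = a := π.injective (ha'b.trans hab.symm)
    subst this
    exact ⟨a', ha, ha'e⟩
  · rintro ⟨a, ha, hae⟩
    exact ⟨π a, mem_image_of_mem π ha, Sym2.mem_map.2 ⟨a, hae, rfl⟩⟩

/-- **Relabelling preserves the number of matching edges meeting a set**: `x_{π·M}(π A) = x_M(A)`. [cite: Rothvoss2017, §2 (PDF p. 5)] -/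
theorem card_meet_perm (π : Equiv.Perm (Fin n)) (A : Finset (Fin n)) (M : PMatch n) :
    ((π • M).1.filter fun e => ∃ a ∈ A.image π, a ∈ e).card = (M.1.filter fun e => ∃ a ∈ A, a ∈ e).card := by
  classical
  rw [PMSol.smul_val]
  symm
  refine card_bij' (fun e _ => Sym2.map π e) (fun e _ => Sym2.map ⇑π⁻¹ e) ?_ ?_ ?_ ?_
  · intro e he
    rw [mem_filter] at he ⊢
    exact ⟨mem_image_of_mem _ he.1, (meets_image_map_iff π A e).2 he.2⟩
  · intro e he
    rw [mem_filter] at he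
    obtain ⟨e', he', rfl⟩ := mem_image.1 he.1
    rw [mem_filter, sym2_map_inv_map]
    exact ⟨he', (meets_image_map_iff π A e').1 he.2⟩
  · intro e _
    exact sym2_map_inv_map π e
  · intro e _
    exact sym2_map_map_inv π e

/-- **The matching average of the kernel depends only on `|U|`**: `Σ_M knapsackMoment |M| (t/2) x_M(U)` is the same for all sets of equal
size (`𝔖ₙ`-transitivity on sets + relabelling of matchings). [cite: Rothvoss2017, §2 (PDF p. 6)] -/
theorem sum_pmatch_kernel_eq_of_card_eq (t : ℕ) {U U' : Finset (Fin n)} (h : U.card = U'.card) :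
    ∑ M : PMatch n, knapsackMoment M.1.card ((t : ℝ) / 2) (M.1.filter fun e => ∃ a ∈ U, a ∈ e).card =
      ∑ M : PMatch n, knapsackMoment M.1.card ((t : ℝ) / 2) (M.1.filter fun e => ∃ a ∈ U', a ∈ e).card := by
  obtain ⟨π, rfl⟩ := exists_perm_image_eq U U' h
  -- reindex the matchings by `M ↦ π • M`
  let eM : PMatch n ≃ PMatch n := MulAction.toPerm π
  calc ∑ M : PMatch n, knapsackMoment M.1.card ((t : ℝ) / 2) (M.1.filter fun e => ∃ a ∈ U, a ∈ e).card
      = ∑ M : PMatch n, knapsackMoment (π • M).1.card ((t : ℝ) / 2)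
          ((π • M).1.filter fun e => ∃ a ∈ U.image π, a ∈ e).card := by
        refine sum_congr rfl fun M _ => ?_
        rw [card_meet_perm π U M]
        have h1 := two_mul_card_pmatch M
        have h2 := two_mul_card_pmatch (π • M)
        congr 1
        omega
    _ = ∑ M : PMatch n, knapsackMoment M.1.card ((t : ℝ) / 2) (M.1.filter fun e => ∃ a ∈ U.image π, a ∈ e).card :=
        Equiv.sum_comp eM (fun M => knapsackMoment M.1.card ((t : ℝ) / 2) (M.1.filter fun e => ∃ a ∈ U.image π, a ∈ e).card)

/-! ### §2 Unbiasedness -/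

/-- The superset identity of `…VirtualKernel` on `K_n`: for `|A| ≤ t ≤ n/2`,
`Σ_{|U| = t, A ⊆ U} K(x_M(U)) = K(x_M(A))`. [cite: Grigoriev2001, Lemma 1.4 (PDF p. 8)] -/
theorem sum_supersets_kernel_univ (M : PMatch n) {t : ℕ} (ht : 2 * t ≤ n) (A : Finset (Fin n)) (hA : A.card ≤ t) :
    ∑ U ∈ (univ.powersetCard t).filter (fun U => A ⊆ U),
        knapsackMoment M.1.card ((t : ℝ) / 2) (M.1.filter fun e => ∃ a ∈ U, a ∈ e).card =
      knapsackMoment M.1.card ((t : ℝ) / 2) (M.1.filter fun e => ∃ a ∈ A, a ∈ e).card := by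
  have hM : t ≤ M.1.card := by have := two_mul_card_pmatch M; omega
  have h := sum_supersets_knapsackMoment M.2 hM (t - A.card) A (subset_univ A) (by omega)
  have hset : (univ.powersetCard t).filter (fun U => A ⊆ U) =
      (univ : Finset (Fin n)).powerset.filter (fun U => U.card = t ∧ A ⊆ U) := by
    ext U
    simp only [mem_filter, mem_powersetCard, mem_powerset, subset_univ, true_and]
  rw [hset]
  convert h

/-- **Unbiasedness on monomials.** For `|A| ≤ t` and `2t ≤ n`:
`Σ_M knapsackMoment |M| (t/2) x_M(A) = |PM_n| · C(n − |A|, t − |A|) / C(n, t)` — the matching average of Grigoriev's virtual value of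
`ζ_A` is the probability that a uniform `t`-cut contains `A`. [cite: Grigoriev2001, Lemma 1.4 (PDF p. 8)] [cite: Rothvoss2017, §2 (PDF p. 6)] -/
theorem sum_pmatch_knapsackMoment_meet {t : ℕ} (ht : 2 * t ≤ n) (A : Finset (Fin n)) (hA : A.card ≤ t) :
    ∑ M : PMatch n, knapsackMoment M.1.card ((t : ℝ) / 2) (M.1.filter fun e => ∃ a ∈ A, a ∈ e).card =
      (Fintype.card (PMatch n) : ℝ) * ((n - A.card).choose (t - A.card) : ℕ) / (n.choose t : ℕ) := by
  classical
  -- the common value `c` of the inner sums over `t`-sets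
  have htn : t ≤ n := by omega
  obtain ⟨U₀, hU₀⟩ : ∃ U₀ : Finset (Fin n), U₀.card = t := by
    obtain ⟨s, hs⟩ := Finset.exists_subset_card_eq (s := (univ : Finset (Fin n))) (n := t)
      (by rw [card_univ, Fintype.card_fin]; exact htn)
    exact ⟨s, hs.2⟩
  set c : ℝ := ∑ M : PMatch n, knapsackMoment M.1.card ((t : ℝ) / 2) (M.1.filter fun e => ∃ a ∈ U₀, a ∈ e).card with hc
  -- every `t`-set has inner sum `c`
  have hconst : ∀ U ∈ univ.powersetCard t,
      ∑ M : PMatch n, knapsackMoment M.1.card ((t : ℝ) / 2) (M.1.filter fun e => ∃ a ∈ U, a ∈ e).card = c := by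
    intro U hU
    exact sum_pmatch_kernel_eq_of_card_eq t ((mem_powersetCard.1 hU).2.trans hU₀.symm)
  -- reduce `A` to its `t`-supersets and swap the sums
  have hswap : ∀ B : Finset (Fin n), B.card ≤ t →
      ∑ M : PMatch n, knapsackMoment M.1.card ((t : ℝ) / 2) (M.1.filter fun e => ∃ a ∈ B, a ∈ e).card =
        (((univ.powersetCard t).filter (fun U => B ⊆ U)).card : ℝ) * c := by
    intro B hB
    calc ∑ M : PMatch n, knapsackMoment M.1.card ((t : ℝ) / 2) (M.1.filter fun e => ∃ a ∈ B, a ∈ e).card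
        = ∑ M : PMatch n, ∑ U ∈ (univ.powersetCard t).filter (fun U => B ⊆ U),
            knapsackMoment M.1.card ((t : ℝ) / 2) (M.1.filter fun e => ∃ a ∈ U, a ∈ e).card :=
          sum_congr rfl fun M _ => (sum_supersets_kernel_univ M ht B hB).symm
      _ = ∑ U ∈ (univ.powersetCard t).filter (fun U => B ⊆ U),
            ∑ M : PMatch n, knapsackMoment M.1.card ((t : ℝ) / 2) (M.1.filter fun e => ∃ a ∈ U, a ∈ e).card := sum_comm
      _ = ∑ _U ∈ (univ.powersetCard t).filter (fun U => B ⊆ U), c :=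
          sum_congr rfl fun U hU => hconst U (mem_filter.1 hU).1
      _ = (((univ.powersetCard t).filter (fun U => B ⊆ U)).card : ℝ) * c := by rw [sum_const, nsmul_eq_mul]
  -- the value of `c` from `B = ∅`
  have hempty := hswap ∅ (by simp)
  have hK0 : ∀ M : PMatch n, knapsackMoment M.1.card ((t : ℝ) / 2) (M.1.filter fun e => ∃ a ∈ (∅ : Finset (Fin n)), a ∈ e).card = 1 := by
    intro M
    have : (M.1.filter fun e => ∃ a ∈ (∅ : Finset (Fin n)), a ∈ e) = ∅ := filter_eq_empty_iff.2 (by simp)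
    rw [this, card_empty]
    simp [knapsackMoment]
  simp only [hK0, sum_const, card_univ, nsmul_eq_mul, mul_one, empty_subset, filter_true_of_mem (fun _ _ => trivial)] at hempty
  rw [card_powersetCard, card_univ, Fintype.card_fin] at hempty
  -- `c = |PM| / C(n,t)`
  have hchoose : (0 : ℝ) < (n.choose t : ℕ) := by exact_mod_cast Nat.choose_pos htn
  have hcval : c = (Fintype.card (PMatch n) : ℝ) / (n.choose t : ℕ) := by
    rw [eq_div_iff hchoose.ne', mul_comm]; exact hempty.symm
  -- count the supersets of `A`
  rw [hswap A hA, card_filter_powersetCard_superset (subset_univ A) hA, card_univ, Fintype.card_fin, hcval]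
  ring

/-- `#{U : |U| = t, A ⊆ U} = C(n − |A|, t − |A|)` summed against coefficients: `Σ_{|U|=t} (zeta q)(U) = Σ_A q_A · C(n − |A|, t − |A|)` for `q`
supported on `|A| ≤ t`. [cite: Rothvoss2017, §2 (PDF p. 6)] -/
theorem sum_powersetCard_zeta_eq (t : ℕ) (q : Finset (Fin n) → ℝ) (hq : ∀ A, t < A.card → q A = 0) :
    ∑ U ∈ univ.powersetCard t, zeta q U = ∑ A : Finset (Fin n), q A * (((n - A.card).choose (t - A.card) : ℕ) : ℝ) := by
  classical
  calc ∑ U ∈ univ.powersetCard t, zeta q U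
      = ∑ U ∈ univ.powersetCard t, ∑ A ∈ U.powerset, q A := by simp only [zeta_apply]
    _ = ∑ U ∈ univ.powersetCard t, ∑ A : Finset (Fin n), if A ⊆ U then q A else 0 := by
        refine sum_congr rfl fun U _ => ?_
        rw [← sum_filter]
        refine sum_congr ?_ fun _ _ => rfl
        ext A; simp
    _ = ∑ A : Finset (Fin n), ∑ U ∈ univ.powersetCard t, if A ⊆ U then q A else 0 := sum_comm
    _ = ∑ A : Finset (Fin n), q A * (((n - A.card).choose (t - A.card) : ℕ) : ℝ) := by
        refine sum_congr rfl fun A _ => ?_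
        rw [← sum_filter, sum_const, nsmul_eq_mul, mul_comm]
        by_cases hAt : A.card ≤ t
        · rw [card_filter_powersetCard_superset (subset_univ A) hAt, card_univ, Fintype.card_fin]
        · rw [hq A (not_le.1 hAt), zero_mul, zero_mul]

/-- **Unbiasedness of the averaged Grigoriev functional.** For `2t ≤ n` and every coefficient vector `q` supported on sets of size `≤ t`:
`Σ_M Σ_A q_A · knapsackMoment |M| (t/2) x_M(A) = (|PM_n| / C(n,t)) · Σ_{|U| = t} (zeta q)(U)` — the matching average of the virtual
value of `f = zeta q` is the uniform mean of `f` over the `t`-cuts (eng MEMO-9's mean checks `E_M[Φ_K(X,M)] = μ(X)`, exactly).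
[cite: Grigoriev2001, Lemma 1.4 (PDF p. 8)] [cite: Rothvoss2017, §2 (PDF p. 6)] -/
theorem sum_pmatch_virtual_value_eq {t : ℕ} (ht : 2 * t ≤ n) (q : Finset (Fin n) → ℝ) (hq : ∀ A, t < A.card → q A = 0) :
    ∑ M : PMatch n, ∑ A : Finset (Fin n), q A * knapsackMoment M.1.card ((t : ℝ) / 2) (M.1.filter fun e => ∃ a ∈ A, a ∈ e).card =
      (Fintype.card (PMatch n) : ℝ) / (n.choose t : ℕ) * ∑ U ∈ univ.powersetCard t, zeta q U := by
  rw [sum_comm, sum_powersetCard_zeta_eq t q hq, mul_sum]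
  refine sum_congr rfl fun A _ => ?_
  by_cases hAt : A.card ≤ t
  · rw [← mul_sum, sum_pmatch_knapsackMoment_meet ht A hAt]
    ring
  · rw [hq A (not_le.1 hAt)]
    simp

end Summit.PneNP.PneNP.Theorems.ChebyshevTracialDesignVirtualUnbiased
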